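import Summits.HodgeConjecture.HodgeConjecture.Theorems.Ring2WeilCoverageCMFieldRationalPrimeRule
import Summits.HodgeConjecture.HodgeConjecture.Theorems.Ring2WeilCoverageCMFieldAllPrimesK
import Summits.HodgeConjecture.HodgeConjecture.Theorems.Ring2WeilCoverageCMFieldAllPrimesJ
import HarnessLib

/-!
# Ring 2 — Weil-family coverage, CM-field rows: the QUADRATIC CHARACTER OF THE ROOTS of the five cyclic carriers
  modulo a split prime — `2 + √2` is a square mod `ℓ` iff `ℓ ≡ ±1 (mod 16)`; the roots of `S² + 5S + 5` are squares
  mod `ℓ` iff `ℓ ≡ 1 (mod 5)` (WEIL-FAMILY-COVERAGE «## b03», cell (xxi‴), part 23)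

research route conditional on HC_CM; not a corollary; Q11.4-sentence-2 already refuted in dim ≥ 3.

Part 22 reduced the class `[ℓ]` of a rational prime `ℓ` SPLIT in `F` (Deligne's quadratic carrier `R = S² + pS + q`,
`E = F(√θ)`, rows `F^×/Nm_{E/F}(E^×)` [cite: Deligne1982HodgeCycles, §4 p. 30, (1), Cor. 4.2]) to the quadratic
character of the roots `r̄ ∈ 𝔽_ℓ` of `R̄`.  For the five CYCLIC quartic CM fields of the census this character is
not a Legendre symbol of a rational integer (the obstruction is a quartic-residue condition), but it IS a congruence
on `ℓ`, because the fields are abelian (`⊂ ℚ(ζ₁₆), ℚ(ζ₄₈), ℚ(ζ₅), ℚ(ζ₄₀), ℚ(ζ₆₀)`).  This file computes it in `𝔽_ℓ`,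
reading the Frobenius of `ζ₁₆` resp. `ζ₅` WITHOUT any global reciprocity, from the devices of parts IX-A/G/J/K:

* §58 square classes in `𝔽_ℓ`: `ab` is a square iff `a, b` have the same character.
* §59 **`ε₁₆`: for `s̄² = 2` in `𝔽_ℓ`, `2 + s̄` is a square ⟺ `ℓ ≡ ±1 (mod 16)`** (both signs of `s̄` at once:
  `(2 + s̄)(2 - s̄) = 2` is a square).  `ℓ ≡ 1`: `ζ⁸ = -1` in `𝔽_ℓ`, `2 ± (ζ² - ζ⁶) = (ζ ∓ ζ⁷)²`-type identities;
  `ℓ ≡ 15`: part G (`x² = s̄ - 2` insoluble) and `-1` a non-square; `ℓ ≡ 7`: part K (`s̄ - 2` a square) and `-1` a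
  non-square; `ℓ ≡ 9`: `√-1, √-2 ∈ 𝔽_ℓ` and part IX-A's `16 ∣ ℓ - 1` device.  (`2 + √2 = (ζ₁₆ + ζ₁₆⁻¹)²`:
  the splitting of `ℓ` in `ℚ(ζ₁₆)⁺ = ℚ(√(2+√2))`.)
* §60 **`ε₅`: a root `k̄` of `S² + 5S + 5` in `𝔽_ℓ` is a square ⟺ `ℓ ≡ 1 (mod 5)`** (`ℓ ≡ 4`: part IX-A, a square
  root yields `ζ₅ ∈ 𝔽_ℓ`; `ℓ ≡ 1`: part J's root `e` of `T⁴ + 5T² + 5`, `k̄ ∈ {e², 5/e²}`).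
* §61 the ROOT CHARACTERS of the five cyclic carriers: `S² + 12S + 18` (`r̄ = -3(2 + s̄)`), `S² + 10S + 20`
  (`r̄ = 2k̄`), `S² + 15S + 45` (`r̄ = 3k̄`), `S² + 5S + 5` (`r̄ = k̄`), `S² + 4S + 2` (`r̄ = -(2 + s̄)`), each as
  «`r̄` square ⟺ congruence on `ℓ`».
Part 24 feeds these into part 22 and assembles the complete prime rules (conductors `48, 40, 60`; `5, 16` re-derived).
No new definition, no named fact, no sorry; nothing about the Hodge conjecture is asserted.
-/

noncomputable section

set_option linter.dupNamespace false

open Polynomial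

namespace Summit.HodgeConjecture.HodgeConjecture.Ring2.WeilCoverageCM

section Residues

variable {ℓ : ℕ} [hℓ : Fact ℓ.Prime]

/-! ### §58 Square classes in `𝔽_ℓ` -/

/-- **`ab` is a square in `𝔽_ℓ` iff `a` and `b` have the same quadratic character** (`a, b ≠ 0`; part 15's
`isSquare_intCast_mul_iff` for residues rather than integers). [folklore] -/
theorem isSquare_mul_iff_isSquare_iff_zmod {a b : ZMod ℓ} (ha : a ≠ 0) (hb : b ≠ 0) :
    IsSquare (a * b) ↔ (IsSquare a ↔ IsSquare b) := by
  obtain ⟨a', rfl⟩ := ZMod.intCast_surjective a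
  obtain ⟨b', rfl⟩ := ZMod.intCast_surjective b
  exact isSquare_intCast_mul_iff ha hb

/-- For `ℓ ≡ 3 (mod 4)` (`-1` a non-square): `-a` is a square iff `a` is not (`a ≠ 0`). [folklore] -/
theorem isSquare_neg_iff_not_isSquare_of_mod_four {a : ZMod ℓ} (ha : a ≠ 0) (h4 : ℓ % 4 = 3) :
    IsSquare (-a) ↔ ¬ IsSquare a := by
  have hm1 : ¬ IsSquare (-1 : ZMod ℓ) := by rw [ZMod.exists_sq_eq_neg_one_iff]; omega
  have h := isSquare_mul_iff_isSquare_iff_zmod (neg_ne_zero.2 (one_ne_zero' (ZMod ℓ))) ha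
  rw [neg_one_mul] at h
  rw [h]
  tauto

/-! ### §59 `ε₁₆`: `2 + √2` is a square mod `ℓ` iff `ℓ ≡ ±1 (mod 16)` -/

/-- `s̄² = 2` in `𝔽_ℓ` (`ℓ` odd) forces `ℓ ≡ ±1 (mod 8)`. [folklore] -/
theorem mod_eight_of_sq_eq_two (h2 : ℓ ≠ 2) {s : ZMod ℓ} (hs : s ^ 2 = 2) : ℓ % 8 = 1 ∨ ℓ % 8 = 7 :=
  (ZMod.exists_sq_eq_two_iff h2).1 ⟨s, by rw [← hs, sq]⟩

/-- `2 + s̄ ≠ 0` for `s̄² = 2` (`(2 + s̄)(2 - s̄) = 2 ≠ 0`, `ℓ` odd). [folklore] -/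
theorem two_add_ne_zero_of_sq_eq_two (h2 : ℓ ≠ 2) {s : ZMod ℓ} (hs : s ^ 2 = 2) : 2 + s ≠ 0 := by
  have h2' : (2 : ZMod ℓ) ≠ 0 := by exact_mod_cast natCast_prime_ne_zero_zmod Nat.prime_two h2
  intro h
  apply h2'
  linear_combination (2 - s) * h + hs

/-- **`ℓ ≡ 1 (mod 16)`: `2 + s̄` is a square** — with `ζ⁸ = -1` in `𝔽_ℓ` (part K), `s₁ = ζ² - ζ⁶` has `s₁² = 2`,
`2 + s₁ = (ζ - ζ⁷)²`, `2 - s₁ = (ζ³ - ζ⁵)²`, and `s̄ = ±s₁`. [folklore] -/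
theorem isSquare_two_add_of_mod_sixteen_one (h16 : ℓ % 16 = 1) (s : ZMod ℓ) (hs : s ^ 2 = 2) :
    IsSquare (2 + s) := by
  obtain ⟨ζ, hζ⟩ := exists_pow_eight_eq_neg_one_of_mod_sixteen_one (ℓ := ℓ) h16
  obtain ⟨s₁, hs₁⟩ : ∃ s₁ : ZMod ℓ, s₁ = ζ ^ 2 - ζ ^ 6 := ⟨_, rfl⟩
  have hs₁sq : s₁ ^ 2 = 2 := by rw [hs₁]; linear_combination (ζ ^ 4 - 2) * hζ
  have hplus : 2 + s₁ = (ζ - ζ ^ 7) * (ζ - ζ ^ 7) := by rw [hs₁]; linear_combination (2 - ζ ^ 6) * hζ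
  have hminus : 2 - s₁ = (ζ ^ 3 - ζ ^ 5) * (ζ ^ 3 - ζ ^ 5) := by rw [hs₁]; linear_combination (2 - ζ ^ 2) * hζ
  have hss : (s - s₁) * (s + s₁) = 0 := by linear_combination hs - hs₁sq
  rcases mul_eq_zero.1 hss with h | h
  · rw [sub_eq_zero.1 h]; exact ⟨_, hplus⟩
  · rw [show s = -s₁ by linear_combination h, ← sub_eq_add_neg]; exact ⟨_, hminus⟩

/-- **`ℓ ≡ 15 (mod 16)`: `2 + s̄` is a square** — else, `-1` being a non-square (`ℓ ≡ 3 (mod 4)`), `-(2 + s̄) = x²`,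
i.e. `x² = (-s̄) - 2` with `(-s̄)² = 2`, which part G forbids. [folklore] -/
theorem isSquare_two_add_of_mod_sixteen_fifteen (h16 : ℓ % 16 = 15) (s : ZMod ℓ) (hs : s ^ 2 = 2) :
    IsSquare (2 + s) := by
  by_contra hns
  have hne := two_add_ne_zero_of_sq_eq_two (by omega) hs
  obtain ⟨x, hx⟩ := (isSquare_neg_iff_not_isSquare_of_mod_four hne (by omega)).2 hns
  exact no_sq_eq_sqrt_two_sub_two_of_mod_sixteen h16 (-s) x (by linear_combination hs)
    (by rw [sq, ← hx]; ring)

/-- **`ℓ ≡ 7 (mod 16)`: `2 + s̄` is a NON-square** — part K gives `(-s̄) - 2 = -(2 + s̄)` a square, and `-1` is a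
non-square (`ℓ ≡ 3 (mod 4)`). [folklore] -/
theorem not_isSquare_two_add_of_mod_sixteen_seven (h16 : ℓ % 16 = 7) (s : ZMod ℓ) (hs : s ^ 2 = 2) :
    ¬ IsSquare (2 + s) := by
  have hne := two_add_ne_zero_of_sq_eq_two (by omega) hs
  have h := isSquare_sqrt_two_sub_two_of_mod_sixteen_seven h16 (-s) (by linear_combination hs)
  rw [show -s - 2 = -(2 + s) by ring] at h
  exact (isSquare_neg_iff_not_isSquare_of_mod_four hne (by omega)).1 h

/-- **`ℓ ≡ 9 (mod 16)`: `2 + s̄` is a NON-square** — `√-1, √-2 ∈ 𝔽_ℓ` (`ℓ ≡ 1 (mod 8)`); from `2 + s̄ = t²` the element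
`x = √-1·t` has `x² = (-s̄) - 2`, and part IX-A's device (`ζ₁₆ = (x² + √-2)/(2x)`) forces `16 ∣ ℓ - 1`. [folklore] -/
theorem not_isSquare_two_add_of_mod_sixteen_nine (h16 : ℓ % 16 = 9) (s : ZMod ℓ) (hs : s ^ 2 = 2) :
    ¬ IsSquare (2 + s) := by
  have h2 : ℓ ≠ 2 := by omega
  rintro ⟨t, ht⟩
  obtain ⟨i, hi⟩ := (ZMod.exists_sq_eq_neg_one_iff (p := ℓ)).2 (by omega)
  obtain ⟨σ, hσ⟩ := (ZMod.exists_sq_eq_neg_two_iff h2).2 (by omega)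
  have h := sixteen_dvd_sub_one_of_sq_eq_sqrt_two_sub_two h2 (-s) σ (i * t) (by linear_combination hs)
    (by rw [sq, ← hσ]) (by linear_combination (-t ^ 2) * hi + ht)
  have := hℓ.out.two_le
  omega

/-- **`ε₁₆`.** For an odd prime `ℓ` and `s̄ ∈ 𝔽_ℓ` with `s̄² = 2`: **`2 + s̄` is a square in `𝔽_ℓ` ⟺ `ℓ ≡ ±1 (mod 16)`**
(independently of the sign of `s̄`).  In `ℚ(ζ₁₆)`: `2 + √2 = (ζ₁₆ + ζ₁₆⁻¹)²`, and `ℓ ≡ ±1 (mod 8)` splits completely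
in `ℚ(ζ₁₆)⁺ = ℚ(√(2+√2))` iff `ℓ ≡ ±1 (mod 16)`. [folklore] -/
theorem isSquare_two_add_sqrt_two_iff (h2 : ℓ ≠ 2) (s : ZMod ℓ) (hs : s ^ 2 = 2) :
    IsSquare (2 + s) ↔ ℓ % 16 = 1 ∨ ℓ % 16 = 15 := by
  have h8 := mod_eight_of_sq_eq_two h2 hs
  have h16 : ℓ % 16 = 1 ∨ ℓ % 16 = 15 ∨ ℓ % 16 = 7 ∨ ℓ % 16 = 9 := by omega
  rcases h16 with h | h | h | h
  · exact iff_of_true (isSquare_two_add_of_mod_sixteen_one h s hs) (Or.inl h)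
  · exact iff_of_true (isSquare_two_add_of_mod_sixteen_fifteen h s hs) (Or.inr h)
  · exact iff_of_false (not_isSquare_two_add_of_mod_sixteen_seven h s hs) (by omega)
  · exact iff_of_false (not_isSquare_two_add_of_mod_sixteen_nine h s hs) (by omega)

/-! ### §60 `ε₅`: the roots of `S² + 5S + 5` are squares mod `ℓ` iff `ℓ ≡ 1 (mod 5)` -/

/-- A root `k̄` of `S² + 5S + 5` in `𝔽_ℓ` (`ℓ ≠ 2, 5`) forces `ℓ ≡ ±1 (mod 5)` (`(2k̄ + 5)² = 5`). [folklore] -/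
theorem mod_five_of_root (h2 : ℓ ≠ 2) (h5 : ℓ ≠ 5) {k : ZMod ℓ} (hk : k ^ 2 + 5 * k + 5 = 0) :
    ℓ % 5 = 1 ∨ ℓ % 5 = 4 :=
  (isSquare_five_iff h2 h5).1 ⟨2 * k + 5, by linear_combination (-4 : ZMod ℓ) * hk⟩

/-- **`ℓ ≡ 4 (mod 5)`: no root of `S² + 5S + 5` in `𝔽_ℓ` is a square** (a square root would produce `ζ₅ ∈ 𝔽_ℓ`,
part IX-A `five_dvd_sub_one_of_sq_eq_root`). [folklore] -/
theorem not_isSquare_root_of_mod_five_four (h5 : ℓ % 5 = 4) (k : ZMod ℓ) (hk : k ^ 2 + 5 * k + 5 = 0) :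
    ¬ IsSquare k := by
  rintro ⟨x, hx⟩
  have hℓ2 : ℓ ≠ 2 := by omega
  have hℓ5 : ℓ ≠ 5 := by omega
  have h := five_dvd_sub_one_of_sq_eq_root hℓ2 hℓ5 k x hk (by rw [sq, ← hx])
  have := hℓ.out.two_le
  omega

/-- **`ℓ ≡ 1 (mod 5)`: every root of `S² + 5S + 5` in `𝔽_ℓ` is a square** — part J's root `e` of `T⁴ + 5T² + 5` gives
the square root `e²`; the other root is `5/e²`, and `5` is a square mod `ℓ ≡ ±1 (mod 5)`. [folklore] -/
theorem isSquare_root_of_mod_five_one (h5 : ℓ % 5 = 1) (k : ZMod ℓ) (hk : k ^ 2 + 5 * k + 5 = 0) :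
    IsSquare k := by
  have h2 : ℓ ≠ 2 := by omega
  have hℓ5 : ℓ ≠ 5 := by omega
  obtain ⟨e, he⟩ := exists_root_cmPoly_zeta5 (ℓ := ℓ) h5
  have h5sq : IsSquare (5 : ZMod ℓ) := isSquare_five_of_mod_five h2 (Or.inl h5)
  have h5ne : (5 : ZMod ℓ) ≠ 0 := by exact_mod_cast natCast_prime_ne_zero_zmod (by norm_num : Nat.Prime 5) hℓ5
  have hk₁ : (e ^ 2) ^ 2 + 5 * e ^ 2 + 5 = 0 := by linear_combination he
  have he0 : e ^ 2 ≠ 0 := fun h ↦ h5ne (by rw [h] at hk₁; linear_combination hk₁)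
  have hprod : (k - e ^ 2) * (k + e ^ 2 + 5) = 0 := by linear_combination hk - hk₁
  rcases mul_eq_zero.1 hprod with h | h
  · exact ⟨e, by rw [sub_eq_zero.1 h, sq]⟩
  · have hke : k * e ^ 2 = 5 := by linear_combination e ^ 2 * h - hk₁
    have hk' : k = 5 * (e ^ 2)⁻¹ := by rw [← hke, mul_inv_cancel_right₀ he0]
    rw [hk']
    have he2 : IsSquare (e ^ 2) := ⟨e, sq e⟩
    exact h5sq.mul he2.inv

/-- **`ε₅`.** For a prime `ℓ ≠ 2, 5` and a root `k̄ ∈ 𝔽_ℓ` of `S² + 5S + 5`: **`k̄` is a square ⟺ `ℓ ≡ 1 (mod 5)`**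
(`-(5 ± √5)/2 = (ζ₅^{±1} - ζ₅^{∓1})²`-type squares exist in `𝔽_ℓ` iff `ζ₅ ∈ 𝔽_ℓ`). [folklore] -/
theorem isSquare_zeta5Root_iff (h2 : ℓ ≠ 2) (h5 : ℓ ≠ 5) (k : ZMod ℓ) (hk : k ^ 2 + 5 * k + 5 = 0) :
    IsSquare k ↔ ℓ % 5 = 1 := by
  rcases mod_five_of_root h2 h5 hk with h | h
  · exact iff_of_true (isSquare_root_of_mod_five_one h k hk) h
  · exact iff_of_false (not_isSquare_root_of_mod_five_four h k hk) (by omega)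

/-! ### §61 The root characters of the five cyclic carriers -/

/-- **`ℚ(√-3(2+√2))`, `R = S² + 12S + 18`** (`F = ℚ(√2)`, conductor `48`): a root `r̄ = -3(2 + s̄)`, `s̄² = 2`, of `R̄` in
`𝔽_ℓ` (`ℓ ≠ 2, 3`) is a square ⟺ (`(-3|ℓ) = 1` ⟺ `ℓ ≡ ±1 (mod 16)`). [folklore] -/
theorem isSquare_root_iff_cond48 (h2 : ℓ ≠ 2) (h3 : ℓ ≠ 3) (r : ZMod ℓ) (hr : r ^ 2 + 12 * r + 18 = 0) :
    IsSquare r ↔ (ℓ % 3 = 1 ↔ (ℓ % 16 = 1 ∨ ℓ % 16 = 15)) := by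
  have h3' : (3 : ZMod ℓ) ≠ 0 := by exact_mod_cast natCast_prime_ne_zero_zmod Nat.prime_three h3
  obtain ⟨s, hsdef⟩ : ∃ s : ZMod ℓ, s = -(r + 6) * 3⁻¹ := ⟨_, rfl⟩
  have h3s : 3 * s = -(r + 6) := by rw [hsdef]; field_simp
  have hs : s ^ 2 = 2 := by
    have h : (3 * s) ^ 2 = 9 * 2 := by rw [h3s]; linear_combination hr
    have h' : (9 : ZMod ℓ) * (s ^ 2 - 2) = 0 := by linear_combination h
    have h9 : (9 : ZMod ℓ) ≠ 0 := by rw [show (9 : ZMod ℓ) = 3 * 3 by norm_num]; exact mul_ne_zero h3' h3'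
    exact sub_eq_zero.1 ((mul_eq_zero.1 h').resolve_left h9)
  have hr' : r = -3 * (2 + s) := by linear_combination h3s
  rw [hr', isSquare_mul_iff_isSquare_iff_zmod (neg_ne_zero.2 h3') (two_add_ne_zero_of_sq_eq_two h2 hs),
    isSquare_neg_three_iff h2 h3, isSquare_two_add_sqrt_two_iff h2 s hs]

/-- **`ℚ(√-(5+√5))`, `R = S² + 10S + 20`** (`F = ℚ(√5)`, conductor `40`): a root `r̄ = 2k̄` (`k̄² + 5k̄ + 5 = 0`) of `R̄` in
`𝔽_ℓ` (`ℓ ≠ 2, 5`) is a square ⟺ (`(2|ℓ) = 1` ⟺ `ℓ ≡ 1 (mod 5)`). [folklore] -/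
theorem isSquare_root_iff_cond40 (h2 : ℓ ≠ 2) (h5 : ℓ ≠ 5) (r : ZMod ℓ) (hr : r ^ 2 + 10 * r + 20 = 0) :
    IsSquare r ↔ ((ℓ % 8 = 1 ∨ ℓ % 8 = 7) ↔ ℓ % 5 = 1) := by
  have h2' : (2 : ZMod ℓ) ≠ 0 := by exact_mod_cast natCast_prime_ne_zero_zmod Nat.prime_two h2
  have h5' : (5 : ZMod ℓ) ≠ 0 := by exact_mod_cast natCast_prime_ne_zero_zmod (by norm_num : Nat.Prime 5) h5
  obtain ⟨k, hkdef⟩ : ∃ k : ZMod ℓ, k = r * 2⁻¹ := ⟨_, rfl⟩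
  have h2k : 2 * k = r := by rw [hkdef]; field_simp
  have hk : k ^ 2 + 5 * k + 5 = 0 := by
    have h : (4 : ZMod ℓ) * (k ^ 2 + 5 * k + 5) = 0 := by rw [← h2k] at hr; linear_combination hr
    have h4 : (4 : ZMod ℓ) ≠ 0 := by rw [show (4 : ZMod ℓ) = 2 * 2 by norm_num]; exact mul_ne_zero h2' h2'
    exact (mul_eq_zero.1 h).resolve_left h4
  have hk0 : k ≠ 0 := fun h ↦ h5' (by rw [h] at hk; linear_combination hk)
  rw [← h2k, isSquare_mul_iff_isSquare_iff_zmod h2' hk0, ZMod.exists_sq_eq_two_iff h2,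
    isSquare_zeta5Root_iff h2 h5 k hk]

/-- **`ℚ(√-3(5+√5)/2)`, `R = S² + 15S + 45`** (`F = ℚ(√5)`, conductor `60`): a root `r̄ = 3k̄` (`k̄² + 5k̄ + 5 = 0`) of `R̄`
in `𝔽_ℓ` (`ℓ ≠ 2, 3, 5`) is a square ⟺ (`(3|ℓ) = 1` ⟺ `ℓ ≡ 1 (mod 5)`). [folklore] -/
theorem isSquare_root_iff_cond60 (h2 : ℓ ≠ 2) (h3 : ℓ ≠ 3) (h5 : ℓ ≠ 5) (r : ZMod ℓ)
    (hr : r ^ 2 + 15 * r + 45 = 0) :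
    IsSquare r ↔ ((ℓ % 12 = 1 ∨ ℓ % 12 = 11) ↔ ℓ % 5 = 1) := by
  have h3' : (3 : ZMod ℓ) ≠ 0 := by exact_mod_cast natCast_prime_ne_zero_zmod Nat.prime_three h3
  have h5' : (5 : ZMod ℓ) ≠ 0 := by exact_mod_cast natCast_prime_ne_zero_zmod (by norm_num : Nat.Prime 5) h5
  obtain ⟨k, hkdef⟩ : ∃ k : ZMod ℓ, k = r * 3⁻¹ := ⟨_, rfl⟩
  have h3k : 3 * k = r := by rw [hkdef]; field_simp
  have hk : k ^ 2 + 5 * k + 5 = 0 := by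
    have h : (9 : ZMod ℓ) * (k ^ 2 + 5 * k + 5) = 0 := by rw [← h3k] at hr; linear_combination hr
    have h9 : (9 : ZMod ℓ) ≠ 0 := by rw [show (9 : ZMod ℓ) = 3 * 3 by norm_num]; exact mul_ne_zero h3' h3'
    exact (mul_eq_zero.1 h).resolve_left h9
  have hk0 : k ≠ 0 := fun h ↦ h5' (by rw [h] at hk; linear_combination hk)
  rw [← h3k, isSquare_mul_iff_isSquare_iff_zmod h3' hk0, isSquare_three_iff h2 h3, isSquare_zeta5Root_iff h2 h5 k hk]

/-- **`ℚ(ζ₅)`, `R = S² + 5S + 5`** (`F = ℚ(√5)`, conductor `5`): a root `r̄` of `R̄` in `𝔽_ℓ` (`ℓ ≠ 2, 5`) is a square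
⟺ `ℓ ≡ 1 (mod 5)` (the split half of b03.16 for `ℚ(ζ₅)`, restated for part 22). [folklore] -/
theorem isSquare_root_iff_cond5 (h2 : ℓ ≠ 2) (h5 : ℓ ≠ 5) (r : ZMod ℓ) (hr : r ^ 2 + 5 * r + 5 = 0) :
    IsSquare r ↔ ℓ % 5 = 1 :=
  isSquare_zeta5Root_iff h2 h5 r hr

/-- **`ℚ(√-(2+√2))`, `R = S² + 4S + 2`** (`F = ℚ(√2)`, inside `ℚ(ζ₁₆)`): a root `r̄ = -(2 + s̄)`, `s̄² = 2`, of `R̄` in `𝔽_ℓ`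
(`ℓ` odd) is a square ⟺ (`(-1|ℓ) = 1` ⟺ `ℓ ≡ ±1 (mod 16)`) (the split half of b03.17, restated for part 22).
[folklore] -/
theorem isSquare_root_iff_cond16 (h2 : ℓ ≠ 2) (r : ZMod ℓ) (hr : r ^ 2 + 4 * r + 2 = 0) :
    IsSquare r ↔ (ℓ % 4 = 1 ↔ (ℓ % 16 = 1 ∨ ℓ % 16 = 15)) := by
  obtain ⟨s, hsdef⟩ : ∃ s : ZMod ℓ, s = -(r + 2) := ⟨_, rfl⟩
  have hs : s ^ 2 = 2 := by rw [hsdef]; linear_combination hr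
  have hr' : r = -1 * (2 + s) := by rw [hsdef]; ring
  have hodd : ℓ % 2 = 1 := (Nat.Prime.mod_two_eq_one_iff_ne_two hℓ.out).2 h2
  rw [hr', isSquare_mul_iff_isSquare_iff_zmod (neg_ne_zero.2 one_ne_zero) (two_add_ne_zero_of_sq_eq_two h2 hs),
    ZMod.exists_sq_eq_neg_one_iff, isSquare_two_add_sqrt_two_iff h2 s hs]
  omega

end Residues

end Summit.HodgeConjecture.HodgeConjecture.Ring2.WeilCoverageCM

end
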